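import Summits.AnomalousDissipation.AnomalousDissipation.Theorems.SolenoidalFractalHomogenisationLagrangianStepSidebandPickup
import Mathlib.Analysis.Calculus.Deriv.Mul
import Mathlib.Analysis.InnerProductSpace.LinearMap
import HarnessLib

/-!
# K1L_D `stub_D1_residueTail` (registry v17, stmt-AnomalousDissipation-27980) — lane A4 brick S: THE STATE BOUND of the periodic response against the
# TRANSVERSE part of the source vector, and the slot-integral bound (helper; `--supports stmt-AnomalousDissipation-27980`)

Summits-side helper file of route `SolenoidalFractalHomogenisation` (prover seat `ad-sawtooth-k1loc-p1` g13; lane A of the tail certificate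
`Lines/onelevel-D1-tail-cert.md`, the factor `Bst`/`√PpSq_{j'}(q)` of every case).  Everything proved; no definitions, no named facts, no sorry.
* `source_apply_transversalProj` — the unit source of slot `j` only sees `P_{mⱼ} v`;
* **`response_apply_transversalProj`** — so does THE periodic response: `response t (P_{mⱼ} v) = response t v` on `[0,P]` (uniqueness, `isPeriodicResponse_unique`);
* **`norm_response_apply_le`**, `norm_responseExt_apply_le` — `‖N t v‖ ≤ (8π‖αⱼ‖/min(γ₁,4π²lo'))·‖P_{mⱼ} v‖` (`norm_response_le` against the transverse part);
* `norm_inner_integral_le_of_le` — `‖⟪w, ∫ₐᵇ X⟫‖ ≤ C·|b − a|` from a pointwise bound `‖⟪w, X t⟫‖ ≤ C` (the slot-integral step of every case);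
* `norm_transversalProj_ofReal_sq` — `‖P_m p‖² = Σᵢ ((projPerp m̂)·p)ᵢ²` for a REAL vector `p` (the `PpSq` of the certificate).
NOT a proof of any registered stub, of the crux, or of anomalous dissipation; rung leaf F-D1 infrastructure.
-/

set_option linter.dupNamespace false

noncomputable section

namespace Summit.AnomalousDissipation.AnomalousDissipation.Theorems.SolenoidalFractalHomogenisation.LagrangianStep.Sideband

open Set MeasureTheory Complex Matrix intervalIntegral
open scoped InnerProductSpace
open Literature.Analysis Literature.Analysis.FunctionSpaces Literature.Analysis.FunctionSpaces.Torus
open Literature.Analysis.FluidPDE Literature.Analysis.FluidPDE.Torus Literature.Analysis.FluidPDE.LatticeShear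
open Summit.AnomalousDissipation.AnomalousDissipation.Theorems.SolenoidalFractalHomogenisation.LagrangianStep.ThreeMode (transversalProj_idem)
open Summit.AnomalousDissipation.AnomalousDissipation.Theorems.SolenoidalFractalHomogenisation.PermissibleCarrier (period_pos)

variable {k₀ : ℕ}

/-! ## §1 The source and the response only see the transverse part of the source vector -/

/-- The unit source of slot `j` only sees `P_{mⱼ} v`. [cite: MajdaKramer1999, §2.2.1.3 (cell problem (49), source term)] -/
theorem source_apply_transversalProj (W₁ : LatticeWord k₀) (R : ℕ) (j : Fin k₀) (t : ℝ) (v : EuclideanSpace ℂ (Fin 3)) :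
    source W₁ R j t (transversalProj (W₁.phase j).m v) = source W₁ R j t v := by
  apply PiLp.ext
  intro z
  rw [source_apply, source_apply, sourceComp, _root_.add_apply, _root_.add_apply]
  congr 1
  · split_ifs with h
    · rw [_root_.smul_apply, _root_.smul_apply, h, transversalProj_idem]
    · rfl
  · split_ifs with h
    · rw [_root_.smul_apply, _root_.smul_apply, h, transversalProj_neg_wave, transversalProj_neg_wave, transversalProj_idem]
    · rfl

/-- **THE RESPONSE ONLY SEES `P_{mⱼ} v`**: `response t (P_{mⱼ} v) = response t v` for `t ∈ [0, P]` (`NearIso 𝔸 lo' hi'`, `lo' > 0`, `γ₁ > 0`).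
[cite: SandersVerhulstMurdock2007, Lemma 5.2.7 (linear case)] -/
theorem response_apply_transversalProj (W₁ : LatticeWord k₀) {𝔸 : Torus.Visc4 (Fin 3)} {lo' hi' : ℝ} (h𝔸 : Torus.NearIso 𝔸 lo' hi')
    (hlo' : 0 < lo') {γ₁ : ℝ} (hγ₁ : 0 < γ₁) (R : ℕ) (j : Fin k₀) {t : ℝ} (ht : t ∈ Icc 0 W₁.period) (v : EuclideanSpace ℂ (Fin 3)) :
    response W₁ 𝔸 γ₁ R j t (transversalProj (W₁.phase j).m v) = response W₁ 𝔸 γ₁ R j t v := by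
  have hN := isPeriodicResponse_response_of_nearIso W₁ h𝔸 hlo' hγ₁ R j
  set N := response W₁ 𝔸 γ₁ R j with hNdef
  set Pℝ : EuclideanSpace ℂ (Fin 3) →L[ℝ] EuclideanSpace ℂ (Fin 3) := (transversalProj (W₁.phase j).m).restrictScalars ℝ with hPℝ
  -- `t ↦ N t ∘ P` is a periodic response of the same slot
  have hN₂ : IsPeriodicResponse W₁ 𝔸 γ₁ R j (fun t => (N t).comp Pℝ) := by
    refine ⟨?_, ?_, ?_⟩
    · exact ((ContinuousLinearMap.compL ℝ _ _ _).flip Pℝ).continuous.comp_continuousOn hN.1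
    · intro s hs
      have h := (hN.2.1 s hs).clm_comp (hasDerivAt_const s Pℝ)
      refine h.congr_deriv ?_
      rw [ContinuousLinearMap.comp_zero, add_zero, ContinuousLinearMap.add_comp, ContinuousLinearMap.comp_assoc]
      congr 1
      ext w : 1
      simp only [ContinuousLinearMap.comp_apply, hPℝ, ContinuousLinearMap.coe_restrictScalars', source_apply_transversalProj]
    · show (N W₁.period).comp Pℝ = (N 0).comp Pℝ
      rw [hN.2.2]
  have h := isPeriodicResponse_unique W₁ h𝔸 hlo' hγ₁ hN₂ hN t ht
  have h' := congrArg (fun L : EuclideanSpace ℂ (Fin 3) →L[ℝ] Space R => L v) h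
  simpa [hPℝ] using h'

/-- **THE STATE BOUND AGAINST THE TRANSVERSE PART**: `‖response t v‖ ≤ (8π‖αⱼ‖/min(γ₁,4π²lo'))·‖P_{mⱼ} v‖` on `[0,P]`.
[cite: SandersVerhulstMurdock2007, Lemma 5.2.7 (linear case)] -/
theorem norm_response_apply_le (W₁ : LatticeWord k₀) {𝔸 : Torus.Visc4 (Fin 3)} {lo' hi' : ℝ} (h𝔸 : Torus.NearIso 𝔸 lo' hi')
    (hlo' : 0 < lo') {γ₁ : ℝ} (hγ₁ : 0 < γ₁) (R : ℕ) (j : Fin k₀) {t : ℝ} (ht : t ∈ Icc 0 W₁.period) (v : EuclideanSpace ℂ (Fin 3)) :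
    ‖response W₁ 𝔸 γ₁ R j t v‖ ≤ 8 * Real.pi * ‖slotAmp W₁ j‖ / min γ₁ (4 * Real.pi ^ 2 * lo') * ‖transversalProj (W₁.phase j).m v‖ := by
  rw [← response_apply_transversalProj W₁ h𝔸 hlo' hγ₁ R j ht v]
  exact (ContinuousLinearMap.le_opNorm _ _).trans (mul_le_mul_of_nonneg_right (norm_response_le W₁ h𝔸 hlo' hγ₁ R j ht) (norm_nonneg _))

/-- The same bound for the periodic extension, at every time. [cite: SandersVerhulstMurdock2007, Lemma 5.2.7 (linear case)] -/
theorem norm_responseExt_apply_le (W₁ : LatticeWord k₀) {𝔸 : Torus.Visc4 (Fin 3)} {lo' hi' : ℝ} (h𝔸 : Torus.NearIso 𝔸 lo' hi')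
    (hlo' : 0 < lo') {γ₁ : ℝ} (hγ₁ : 0 < γ₁) (R : ℕ) (j : Fin k₀) (t : ℝ) (v : EuclideanSpace ℂ (Fin 3)) :
    ‖responseExt W₁ 𝔸 γ₁ R j t v‖ ≤ 8 * Real.pi * ‖slotAmp W₁ j‖ / min γ₁ (4 * Real.pi ^ 2 * lo') * ‖transversalProj (W₁.phase j).m v‖ := by
  rw [responseExt_def]
  exact norm_response_apply_le W₁ h𝔸 hlo' hγ₁ R j (Ico_subset_Icc_self (by simpa using toIcoMod_mem_Ico' (period_pos W₁) t)) v

/-! ## §2 The slot-integral step -/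

/-- **From a pointwise bound of the pairing to a bound of the pairing with the slot integral**: if `‖⟪w, X t⟫‖ ≤ C` on `Ι a b` and `X` is
interval-integrable, then `‖⟪w, ∫ₐᵇ X⟫‖ ≤ C·|b − a|` (`Set.uIoc a b`). [folklore] -/
theorem norm_inner_integral_le_of_le {X : ℝ → EuclideanSpace ℂ (Fin 3)} {a b C : ℝ} (hX : IntervalIntegrable X volume a b)
    (w : EuclideanSpace ℂ (Fin 3)) (h : ∀ t ∈ Set.uIoc a b, ‖⟪w, X t⟫_ℂ‖ ≤ C) :
    ‖⟪w, ∫ t in a..b, X t⟫_ℂ‖ ≤ C * |b - a| := by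
  have hcomm : ⟪w, ∫ t in a..b, X t⟫_ℂ = ∫ t in a..b, ⟪w, X t⟫_ℂ := by
    have h1 := ((innerSL ℂ w).intervalIntegral_comp_comm hX).symm
    simpa only [innerSL_apply_apply] using h1
  rw [hcomm]
  exact intervalIntegral.norm_integral_le_of_norm_le_const h

/-! ## §3 The transverse part of a real test vector -/

/-- `‖P_m p‖² = Σᵢ ((projPerp m̂)·p)ᵢ²` for a real vector `p` read in `ℂ³` (`m` the wave vector of a lattice phase). [cite: Temam1984, Ch. III §1.1] -/
theorem norm_transversalProj_ofReal_sq (P : LatticePhase) (p : Fin 3 → ℝ) :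
    ‖transversalProj P.m (WithLp.toLp 2 fun i => ((p i : ℝ) : ℂ))‖ ^ 2 = ∑ i, ((projPerp (mhat P)).mulVec p i) ^ 2 := by
  rw [EuclideanSpace.norm_sq_eq]
  refine Finset.sum_congr rfl fun i _ => ?_
  rw [transversalProj_eq_cmat, toEuclideanCLM_map_apply]
  have h : ∑ l, ((projPerp (mhat P) i l : ℝ) : ℂ) * (WithLp.toLp 2 fun i => ((p i : ℝ) : ℂ)) l = (((projPerp (mhat P)).mulVec p i : ℝ) : ℂ) := by
    simp only [Matrix.mulVec, dotProduct]
    push_cast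
    rfl
  rw [h, Complex.norm_real, Real.norm_eq_abs, sq_abs]

end Summit.AnomalousDissipation.AnomalousDissipation.Theorems.SolenoidalFractalHomogenisation.LagrangianStep.Sideband

end
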